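import Mathlib
import HarnessLib
import Literature.Geometry.Manifold.FlowBoxFlow
import Literature.Geometry.Lorentzian.Stationary

/-!
# Gradient-saturated boxes along a level set (crux `NonTrappingHawkingRigidity`,
# stmt-FinalStateConjecture-13896, line `Sketch`, stub S3 helper)

Differential-topology helper for the slab patching (stub S3 `stub_slabPatching`). Let `Y` be a
vector field, `C^∞` on an open set `W` of a manifold `M` modelled on a complete normed space `E`,
and `f` a function `C^∞` on `W` with `df_q(Y q) > 0` at a point `q ∈ W` of the level `{f = c}`.
Then `q` has an open neighbourhood `B ⊆ W` which is a **`Y`-SATURATED BOX over the level `c`**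
(`exists_saturatedBox`): every `x ∈ B` with `f x ≥ c` is joined, INSIDE `B`, to a point with
`f < c` by an integral curve of `Y` ending at `x` (an integral curve `γ` of `Y` on an open
parameter interval `(a', b') ∋ 0` with `γ 0 = x`, `γ (a', b') ⊆ B` and `f (γ a) < c` for some
`a' < a < 0`).
Construction: in a flow-box chart `χ` of `Y` about `q` (`exists_chart_mfderiv_eq_const`: `Y` is
the constant vector `e = Y q`), `F = f ∘ χ⁻¹` has `∂_e F > 0` near `χ q`, so `F` increases
strictly along the lines `p + s e`; the box is `χ⁻¹` of the union of the translates
`ball (χ q) r + s e`, `|s| < δ`, with `r` so small that `F < c` on `ball (χ q) r - (δ/2) e`.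
Everything is proved; no definitions. Lee 2012, Thm. 9.22 (flow box).
-/

noncomputable section

-- D-0017: single-problem summit, `Summit.<S>.<S>.…` by design
set_option linter.dupNamespace false

namespace Summit.FinalStateConjecture.FinalStateConjecture.Theorems.NonTrappingHawkingRigidity.AzimuthalPartialAnalyticity.SlabPatching

open Set Filter Function Bundle Metric Literature.Geometry.Manifold Literature.Geometry.Lorentzian
open scoped Manifold ContDiff Topology

variable {E : Type*} [NormedAddCommGroup E] [NormedSpace ℝ E] [CompleteSpace E]
  {M : Type*} [TopologicalSpace M] [ChartedSpace E M] [IsManifold 𝓘(ℝ, E) ∞ M]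

omit [CompleteSpace E] in
/-- **Strict increase along a line from a positive directional derivative.** If `F : E → ℝ` is
differentiable at the points `b + s e`, `s ∈ (α, β)`, with `DF(b + s e) e > 0`, then
`s ↦ F (b + s e)` is strictly increasing on `(α, β)` (mean value theorem,
`strictMonoOn_of_deriv_pos`). [folklore] -/
theorem strictMonoOn_line_of_fderiv_pos {F : E → ℝ} {b e : E} {α β : ℝ}
    (hd : ∀ s ∈ Ioo α β, DifferentiableAt ℝ F (b + s • e))
    (hpos : ∀ s ∈ Ioo α β, 0 < fderiv ℝ F (b + s • e) e) :
    StrictMonoOn (fun s : ℝ ↦ F (b + s • e)) (Ioo α β) := by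
  have hderiv : ∀ s ∈ Ioo α β, HasDerivAt (fun s : ℝ ↦ F (b + s • e))
      (fderiv ℝ F (b + s • e) e) s := by
    intro s hs
    have h1 : HasDerivAt (fun s : ℝ ↦ b + s • e) e s := by
      simpa using ((hasDerivAt_id s).smul_const e).const_add b
    exact (hd s hs).hasFDerivAt.comp_hasDerivAt s h1
  refine strictMonoOn_of_deriv_pos (convex_Ioo α β)
    (fun s hs ↦ (hderiv s hs).continuousAt.continuousWithinAt) fun s hs ↦ ?_
  rw [interior_Ioo] at hs
  rw [(hderiv s hs).deriv]
  exact hpos s hs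

/-- **Existence of saturated boxes** (see the module docstring). For `Y` and `f` of class `C^∞`
on an open `W ∋ q` with `f q = c` and `df_q(Y q) > 0`, there is an open `B`, `q ∈ B ⊆ W`, such
that every `x ∈ B` with `c ≤ f x` is the endpoint `γ 0 = x` of an integral curve `γ` of `Y`,
defined on an open interval `(a', b') ∋ 0` and staying in `B` there, with `f (γ a) < c` for
some `a' < a < 0`.
Lee 2012, Thm. 9.22 (flow-box coordinates), plus one-variable calculus.
[cite: LeeSmoothManifolds2013, Thm. 9.22] -/
theorem exists_saturatedBox {W : Set M} {f : M → ℝ} {c : ℝ}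
    {Y : Π x : M, TangentSpace 𝓘(ℝ, E) x} {q : M} (hW : IsOpen W) (hq : q ∈ W) (hfq : f q = c)
    (hf : ContMDiffOn 𝓘(ℝ, E) 𝓘(ℝ, ℝ) ∞ f W)
    (hY : ContMDiffOn 𝓘(ℝ, E) (𝓘(ℝ, E).prod 𝓘(ℝ, E)) ∞
      (fun x ↦ (TotalSpace.mk' E x (Y x) : TangentBundle 𝓘(ℝ, E) M)) W)
    (hpos : 0 < mvfderiv 𝓘(ℝ, E) f q (Y q)) :
    ∃ B : Set M, IsOpen B ∧ q ∈ B ∧ B ⊆ W ∧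
      ∀ x ∈ B, c ≤ f x → ∃ (γ : ℝ → M) (a a' b' : ℝ), a' < a ∧ a < 0 ∧ 0 < b' ∧ γ 0 = x ∧
        IsMIntegralCurveOn γ Y (Ioo a' b') ∧ (∀ t ∈ Ioo a' b', γ t ∈ B) ∧ f (γ a) < c := by
  have hYq : Y q ≠ 0 := fun h ↦ by
    rw [h, map_zero] at hpos
    exact lt_irrefl _ hpos
  have hpos' : 0 < (show ℝ from mfderiv 𝓘(ℝ, E) 𝓘(ℝ, ℝ) f q (Y q)) := hpos
  -- flow-box chart for `Y` about `q`, inside `W`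
  obtain ⟨χ, hχ, hqχ, hχW, -, hχv⟩ := exists_chart_mfderiv_eq_const hW hY hq hYq
  set e : E := (show E from Y q) with he
  set p₀ : E := χ q with hp₀
  have hχd : χ.MDifferentiable 𝓘(ℝ, E) 𝓘(ℝ, E) :=
    ⟨(contMDiffOn_of_mem_maximalAtlas hχ).mdifferentiableOn (by simp),
      (contMDiffOn_symm_of_mem_maximalAtlas hχ).mdifferentiableOn (by simp)⟩
  -- `F = f ∘ χ⁻¹` is `C^∞` on the target
  set F : E → ℝ := f ∘ χ.symm with hF
  have hFs : ContMDiffOn 𝓘(ℝ, E) 𝓘(ℝ, ℝ) ∞ F χ.target :=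
    hf.comp ((contMDiffOn_symm_of_mem_maximalAtlas hχ).mono Subset.rfl)
      fun p hp ↦ hχW (χ.map_target hp)
  have hFc : ContDiffOn ℝ ∞ F χ.target := contMDiffOn_iff_contDiffOn.1 hFs
  have hFcont : ContinuousOn F χ.target := hFc.continuousOn
  have hFd : ∀ p ∈ χ.target, DifferentiableAt ℝ F p := fun p hp ↦
    (hFc.differentiableOn (by simp) p hp).differentiableAt (χ.open_target.mem_nhds hp)
  -- the directional derivative `∂_e F (p) = df (Y)` at `χ⁻¹ p`
  have hdir : ∀ p ∈ χ.target, fderiv ℝ F p e = mfderiv 𝓘(ℝ, E) 𝓘(ℝ, ℝ) f (χ.symm p)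
      (Y (χ.symm p)) := by
    intro p hp
    have hx : χ.symm p ∈ χ.source := χ.map_target hp
    have hfd : MDifferentiableAt 𝓘(ℝ, E) 𝓘(ℝ, ℝ) f (χ.symm p) :=
      ((hf _ (hχW hx)).contMDiffAt (hW.mem_nhds (hχW hx))).mdifferentiableAt (by simp)
    have hsd : MDifferentiableAt 𝓘(ℝ, E) 𝓘(ℝ, E) χ.symm p := hχd.symm.mdifferentiableAt hp
    have h1 : fderiv ℝ F p = mfderiv 𝓘(ℝ, E) 𝓘(ℝ, ℝ) F p := (mfderiv_eq_fderiv (f := F)).symm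
    rw [h1, hF, mfderiv_comp p hfd hsd]
    have h2 := hχv _ hx
    rw [χ.right_inv hp] at h2
    show mfderiv 𝓘(ℝ, E) 𝓘(ℝ, ℝ) f (χ.symm p) (mfderiv 𝓘(ℝ, E) 𝓘(ℝ, E) χ.symm p e) = _
    rw [h2]
  have hdir₀ : 0 < fderiv ℝ F p₀ e := by
    rw [hdir p₀ (χ.map_source hqχ), hp₀, χ.left_inv hqχ]
    exact hpos'
  -- `∂_e F > 0` on a ball `ball p₀ ρ ⊆ χ.target`
  have hcontD : ContinuousOn (fun p ↦ fderiv ℝ F p e) χ.target :=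
    (hFc.continuousOn_fderiv_of_isOpen χ.open_target (by simp)).clm_apply continuousOn_const
  obtain ⟨ρ, hρ, hballρ⟩ : ∃ ρ > 0, ball p₀ ρ ⊆ χ.target ∩ {p | 0 < fderiv ℝ F p e} := by
    have ho : IsOpen (χ.target ∩ (fun p ↦ fderiv ℝ F p e) ⁻¹' Ioi 0) :=
      hcontD.isOpen_inter_preimage χ.open_target isOpen_Ioi
    exact Metric.isOpen_iff.1 ho p₀ ⟨χ.map_source hqχ, hdir₀⟩
  have hρt : ball p₀ ρ ⊆ χ.target := fun p hp ↦ (hballρ hp).1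
  have hρpos : ∀ p ∈ ball p₀ ρ, 0 < fderiv ℝ F p e := fun p hp ↦ (hballρ hp).2
  -- sizes: `δ` with `δ ‖e‖ ≤ ρ / 2`, then `r ≤ ρ / 2` with `F < c` on `ball p₀ r - (δ/2) e`
  obtain ⟨δ, hδ, hδe⟩ : ∃ δ > (0 : ℝ), δ * ‖e‖ < ρ / 2 := by
    refine ⟨ρ / (2 * (‖e‖ + 1)) / 2, by positivity, ?_⟩
    have h1 : ρ / (2 * (‖e‖ + 1)) / 2 * ‖e‖ ≤ ρ / (2 * (‖e‖ + 1)) / 2 * (‖e‖ + 1) :=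
      mul_le_mul_of_nonneg_left (by linarith) (by positivity)
    have h2 : ρ / (2 * (‖e‖ + 1)) / 2 * (‖e‖ + 1) = ρ / 4 := by
      field_simp
      ring
    linarith
  -- points `b + s e` with `‖b - p₀‖ < ρ/2`, `|s| < δ` lie in `ball p₀ ρ`
  have hline : ∀ b ∈ ball p₀ (ρ / 2), ∀ s ∈ Ioo (-δ) δ, b + s • e ∈ ball p₀ ρ := by
    intro b hb s hs
    rw [mem_ball, dist_eq_norm] at hb ⊢
    have h1 : ‖b + s • e - p₀‖ ≤ ‖b - p₀‖ + ‖s • e‖ := by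
      rw [show b + s • e - p₀ = (b - p₀) + s • e by abel]; exact norm_add_le _ _
    have h2 : ‖s • e‖ = |s| * ‖e‖ := norm_smul s e
    have h3 : |s| * ‖e‖ ≤ δ * ‖e‖ :=
      mul_le_mul_of_nonneg_right (abs_lt.2 hs).le (norm_nonneg e)
    linarith
  -- strict monotonicity along the lines through `ball p₀ (ρ/2)`
  have hmono : ∀ b ∈ ball p₀ (ρ / 2), StrictMonoOn (fun s : ℝ ↦ F (b + s • e)) (Ioo (-δ) δ) :=
    fun b hb ↦ strictMonoOn_line_of_fderiv_pos (fun s hs ↦ hFd _ (hρt (hline b hb s hs)))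
      fun s hs ↦ hρpos _ (hline b hb s hs)
  -- `F (p₀ - (δ/2) e) < c`, and by continuity on a ball of radius `r`
  have hF₀ : F p₀ = c := by
    simp only [hF, comp_apply, hp₀, χ.left_inv hqχ, hfq]
  have hhalf : -(δ / 2) ∈ Ioo (-δ) δ := ⟨by linarith, by linarith⟩
  have hzero : (0 : ℝ) ∈ Ioo (-δ) δ := ⟨by linarith, by linarith⟩
  have hp₀ball : p₀ ∈ ball p₀ (ρ / 2) := mem_ball_self (by linarith)
  have hlt₀ : F (p₀ + (-(δ / 2)) • e) < c := by
    have h := hmono p₀ hp₀ball hhalf hzero (by linarith)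
    simp only [zero_smul, add_zero] at h
    rwa [hF₀] at h
  obtain ⟨r, hr, hr2, hrlt⟩ : ∃ r > (0 : ℝ), r ≤ ρ / 2 ∧
      ∀ b ∈ ball p₀ r, F (b + (-(δ / 2)) • e) < c := by
    have hmem : p₀ + (-(δ / 2)) • e ∈ χ.target := hρt (hline p₀ hp₀ball _ hhalf)
    have h1 : ContinuousAt (fun b : E ↦ b + (-(δ / 2)) • e) p₀ :=
      (continuous_id.add continuous_const).continuousAt
    have h2 : ContinuousAt F (p₀ + (-(δ / 2)) • e) :=
      hFcont.continuousAt (χ.open_target.mem_nhds hmem)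
    have hca : ContinuousAt (fun b ↦ F (b + (-(δ / 2)) • e)) p₀ :=
      ContinuousAt.comp (f := fun b : E ↦ b + (-(δ / 2)) • e) h2 h1
    have hev := hca.eventually_lt_const hlt₀
    obtain ⟨r, hr, hrball⟩ := Metric.eventually_nhds_iff.1 hev
    refine ⟨min r (ρ / 2), lt_min hr (by linarith), min_le_right _ _, fun b hb ↦ hrball ?_⟩
    exact lt_of_lt_of_le hb (min_le_left _ _)
  have hrρ : ball p₀ r ⊆ ball p₀ (ρ / 2) := ball_subset_ball hr2
  -- the tube `T` and the box `B = χ⁻¹ T`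
  set T : Set E := {p | ∃ s ∈ Ioo (-δ) δ, p - s • e ∈ ball p₀ r} with hT
  have hTo : IsOpen T := by
    have h : T = ⋃ s ∈ Ioo (-δ) δ, (fun p ↦ p - s • e) ⁻¹' ball p₀ r := by
      ext p; simp [hT]
    rw [h]
    exact isOpen_biUnion fun s _ ↦ (continuous_id.sub continuous_const).isOpen_preimage _
      isOpen_ball
  have hTρ : T ⊆ ball p₀ ρ := by
    rintro p ⟨s, hs, hb⟩
    have h := hline _ (hrρ hb) s hs
    rwa [sub_add_cancel] at h
  have hTt : T ⊆ χ.target := hTρ.trans hρt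
  set B : Set M := χ.source ∩ χ ⁻¹' T with hB
  have hBo : IsOpen B := χ.isOpen_inter_preimage hTo
  have hqB : q ∈ B := ⟨hqχ, 0, hzero, by simp [hp₀, mem_ball_self hr]⟩
  refine ⟨B, hBo, hqB, fun x hx ↦ hχW hx.1, fun x hx hcx ↦ ?_⟩
  -- the saturation property at `x ∈ B` with `c ≤ f x`
  obtain ⟨hxs, s, hs, hb⟩ := hx
  set p : E := χ x with hp
  set b : E := p - s • e with hbdef
  have hpb : ∀ t : ℝ, p + t • e = b + (s + t) • e := fun t ↦ by
    simp only [hbdef, add_smul]; abel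
  have hFp : F p = f x := by simp only [hF, comp_apply, hp, χ.left_inv hxs]
  -- `s > -δ/2`, since `F` increases along the line and `F (b - (δ/2) e) < c ≤ F p`
  have hbr : b ∈ ball p₀ r := hb
  have hslt : -(δ / 2) < s := by
    by_contra hle
    push Not at hle
    have hle' : F (b + s • e) ≤ F (b + (-(δ / 2)) • e) := by
      rcases hle.lt_or_eq with hlt | heq
      · exact ((hmono b (hrρ hbr)).lt_iff_lt hs hhalf).2 hlt |>.le
      · rw [heq]
    have h1 : F (b + s • e) = F p := by rw [hbdef, sub_add_cancel]
    have h2 := hrlt b hbr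
    linarith [hFp ▸ h1 ▸ hle', hcx]
  -- the integral curve `γ t = χ⁻¹ (p + t e)`
  set γ : ℝ → M := fun t ↦ χ.symm (p + t • e) with hγ
  have hmemT : ∀ t : ℝ, s + t ∈ Ioo (-δ) δ → p + t • e ∈ T := fun t ht ↦
    ⟨s + t, ht, by rw [hpb t, add_sub_cancel_right]; exact hbr⟩
  refine ⟨γ, -(s + δ / 2), -(s + δ), δ - s, by linarith, by linarith, by linarith [hs.2], ?_,
    ?_, ?_, ?_⟩
  · simp only [hγ, zero_smul, add_zero, hp, χ.left_inv hxs]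
  · refine isMIntegralCurveOn_symm_add_smul hχ hχv fun t ht ↦ hTt (hmemT t ⟨?_, ?_⟩)
    · linarith [ht.1]
    · linarith [ht.2]
  · intro t ht
    have hmem : p + t • e ∈ T := hmemT t ⟨by linarith [ht.1], by linarith [ht.2]⟩
    refine ⟨χ.map_target (hTt hmem), ?_⟩
    show χ (χ.symm (p + t • e)) ∈ T
    rwa [χ.right_inv (hTt hmem)]
  · show f (χ.symm (p + (-(s + δ / 2)) • e)) < c
    have h : p + (-(s + δ / 2)) • e = b + (-(δ / 2)) • e := by
      rw [hpb]; congr 1; ring_nf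
    rw [h]
    exact hrlt b hbr

/-- **Registered form (sub-goal `stub_slabPatching_boxes` of stub S3 `stub_slabPatching`):
existence of saturated boxes** on the carrier of a stationary black hole
(`exists_saturatedBox`). [cite: LeeSmoothManifolds2013, Thm. 9.22] -/
theorem stub_slabPatching_boxes :
    ∀ (𝓑 : StationaryAFBlackHole.{0}) (W : Set 𝓑.carrier) (f : 𝓑.carrier → ℝ) (c : ℝ)
      (Y : Π x : 𝓑.carrier, TangentSpace (𝓡 4) x) (q : 𝓑.carrier),
      IsOpen W → q ∈ W → f q = c →
      ContMDiffOn (𝓡 4) 𝓘(ℝ, ℝ) ((⊤ : ℕ∞) : WithTop ℕ∞) f W →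
      ContMDiffOn (𝓡 4) ((𝓡 4).prod 𝓘(ℝ, E4)) ((⊤ : ℕ∞) : WithTop ℕ∞)
        (fun x ↦ (Bundle.TotalSpace.mk' E4 x (Y x) : TangentBundle (𝓡 4) 𝓑.carrier)) W →
      0 < mvfderiv (𝓡 4) f q (Y q) →
      ∃ B : Set 𝓑.carrier, IsOpen B ∧ q ∈ B ∧ B ⊆ W ∧
        ∀ x ∈ B, c ≤ f x → ∃ (γ : ℝ → 𝓑.carrier) (a a' b' : ℝ), a' < a ∧ a < 0 ∧ 0 < b' ∧
          γ 0 = x ∧ IsMIntegralCurveOn γ Y (Set.Ioo a' b') ∧ (∀ t ∈ Set.Ioo a' b', γ t ∈ B) ∧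
          f (γ a) < c := by
  intro 𝓑 W f c Y q hW hq hfq hf hY hpos
  exact exists_saturatedBox hW hq hfq hf hY hpos

end Summit.FinalStateConjecture.FinalStateConjecture.Theorems.NonTrappingHawkingRigidity.AzimuthalPartialAnalyticity.SlabPatching

end
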